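import Summits.QuantumAdvantage.QuantumAdvantage.Theorems.LinnikCubicClassGroupsPureCubicClassGroupFBQPStubRegulatorPeriod
import Summits.QuantumAdvantage.QuantumAdvantage.Theorems.LinnikCubicClassGroupsPureCubicClassGroupFBQPStubCubicFieldFacts
import Literature.NumberTheory.CubicFields.VoronoiReduction
import Literature.NumberTheory.CubicFields.CubicRegulatorBound

/-!
# Crux `LinnikCubicClassGroups.PureCubicClassGroupFBQP` (stmt-QuantumAdvantage-11544) — stub `stub_cubicReduction`

Line `arakelov-giant-step-cycle`, stub `stub_cubicReduction` (T3a′): REDUCTION THEORY IN A CUBIC FIELD OF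
SIGNATURE (1,1). For a cubic number field `K` with a real embedding `σ₁` and a non-real embedding `σ₂`:

1. every nonzero fractional ideal `I` has a UNIQUE element `γ` of least `σ₁` in the unit cylinder
   `{σ₁ > 0, ‖σ₂‖ < 1}`; it is a positive relative minimum of `I` with `N(I) < σ₁ γ ≤ 3 N(I) √|d_K|`
   (`Literature.NumberTheory.CubicFields.exists_cylinder_min`: Minkowski in Mathlib's mixed space);
2. rescaling a positive minimum `θ` of `I` to `1` makes `1` a positive minimum of `θ⁻¹ I`
   (`…one_mem_posRelMinima_spanSingleton_inv_mul`);
3. a reduced ideal `J` (`1` a positive minimum) has `𝓞_K ⊆ J` and `π/(2√|d_K|) ≤ N(J) ≤ 1`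
   (`…reducedIdeal_bounds`);
4. `R_K ≤ |d_K|⁶` (`regulator_le_abs_discr_pow_six`): the least unit `ε` with `σ₁ ε > 1` of S2
   `stub_regulatorPeriod` has `log σ₁ ε = R_K ≤ #{integral ideals of norm ≤ 2√|d_K|/π} · log (3√|d_K|)`
   (`…log_unit_le_ncard_mul_log` with the gap bound `…voronoiSucc_le_mul` and the norm bound
   `…abs_mul_norm_sq_le_of_mem_relMinima`), the count is `≤ ⌊2√|d_K|/π⌋^10 ≤ (2/3)^10 |d_K|^5`
   (`facts_ideals_le` of S4a `stub_cubicFieldFacts`), and `log (3√|d_K|) ≤ 3√|d_K| − 1 ≤ 3|d_K|`.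
-/

namespace Summit.QuantumAdvantage.QuantumAdvantage.Theorems.LinnikCubicClassGroups

open scoped NumberField nonZeroDivisors
open NumberField
open Literature.NumberTheory.CubicFields

/-- **Conjunct (4): `R_K ≤ |d_K|⁶`** for a cubic field `K` with a real embedding `σ₁` and a non-real
embedding `σ₂`: `R_K = log σ₁ ε ≤ #{integral ideals of norm ≤ 2√|d_K|/π} · log (3√|d_K|)
≤ (2/3)^10 |d_K|^5 · 3 |d_K| ≤ |d_K|^6`. -/
theorem regulator_le_abs_discr_pow_six (K : Type) [Field K] [NumberField K] (hdeg : Module.finrank ℚ K = 3)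
    (σ₁ : K →+* ℝ) (σ₂ : K →+* ℂ) (hσ₂ : ∃ z : K, starRingEnd ℂ (σ₂ z) ≠ σ₂ z) :
    Units.regulator K ≤ |(discr K : ℝ)| ^ 6 := by
  obtain ⟨ε, hε, hreg, hmin⟩ := stub_regulatorPeriod K hdeg σ₁ σ₂ hσ₂
  rw [← hreg]
  set d : ℝ := |(discr K : ℝ)| with hd
  have hnorm : ∀ θ ∈ posRelMinima σ₁ σ₂ (1 : FractionalIdeal (𝓞 K)⁰ K),
      |σ₁ θ| * ‖σ₂ θ‖ ^ 2 ≤ 2 * Real.sqrt d / Real.pi := fun θ hθ => by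
    have h := abs_mul_norm_sq_le_of_mem_relMinima hdeg hσ₂ hθ.1
    rwa [FractionalIdeal.absNorm_one, Rat.cast_one, mul_one] at h
  have h := log_unit_le_ncard_mul_log hdeg hσ₂ ε hε hmin (one_mem_posRelMinima_one hdeg hσ₂)
    (G := 3 * Real.sqrt d) (M := 2 * Real.sqrt d / Real.pi) ?_
    (fun μ hμ => voronoiSucc_le_mul hdeg hσ₂ ε hε hμ) hnorm
  swap
  · rw [hd, ← mul_one (1 : ℝ)]
    refine mul_le_mul (by norm_num) ?_ zero_le_one (by norm_num)
    rw [Real.one_le_sqrt, ← Int.cast_abs]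
    exact_mod_cast (abs_discr_gt_two (K := K) (by rw [hdeg]; norm_num)).le.trans' (by norm_num)
  have hd2 : 2 < d := by
    have h2 := abs_discr_gt_two (K := K) (by rw [hdeg]; norm_num)
    rw [hd, ← Int.cast_abs]; exact_mod_cast h2
  have hsq : Real.sqrt d ^ 2 = d := Real.sq_sqrt (by linarith)
  have hs1 : 1 ≤ Real.sqrt d := by rw [Real.one_le_sqrt]; linarith
  have hcount : ({I : Ideal (𝓞 K) | 1 ≤ Ideal.absNorm I ∧
      Ideal.absNorm I ≤ ⌊2 * Real.sqrt d / Real.pi⌋₊}.ncard : ℝ) ≤ (2 / 3) ^ 10 * d ^ 5 := by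
    have h1 := facts_ideals_le (K := K) hdeg ⌊2 * Real.sqrt d / Real.pi⌋₊
    have h2 : (⌊2 * Real.sqrt d / Real.pi⌋₊ : ℝ) ≤ 2 * Real.sqrt d / 3 := by
      calc (⌊2 * Real.sqrt d / Real.pi⌋₊ : ℝ) ≤ 2 * Real.sqrt d / Real.pi := Nat.floor_le (by positivity)
        _ ≤ 2 * Real.sqrt d / 3 := by gcongr; exact Real.pi_gt_three.le
    calc ({I : Ideal (𝓞 K) | 1 ≤ Ideal.absNorm I ∧ Ideal.absNorm I ≤ ⌊2 * Real.sqrt d / Real.pi⌋₊}.ncard : ℝ)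
        ≤ ((⌊2 * Real.sqrt d / Real.pi⌋₊ ^ 10 : ℕ) : ℝ) := by exact_mod_cast h1
      _ = (⌊2 * Real.sqrt d / Real.pi⌋₊ : ℝ) ^ 10 := by push_cast; ring
      _ ≤ (2 * Real.sqrt d / 3) ^ 10 := pow_le_pow_left₀ (by positivity) h2 10
      _ = (2 / 3) ^ 10 * (Real.sqrt d ^ 2) ^ 5 := by ring
      _ = (2 / 3) ^ 10 * d ^ 5 := by rw [hsq]
  have hlog : Real.log (3 * Real.sqrt d) ≤ 3 * d := by
    have h1 := Real.log_le_sub_one_of_pos (show 0 < 3 * Real.sqrt d by positivity)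
    have h2 : Real.sqrt d ≤ d := by nlinarith
    linarith
  have hlog0 : 0 ≤ Real.log (3 * Real.sqrt d) := Real.log_nonneg (by linarith)
  have hd0 : 0 < d := by linarith
  calc Real.log (σ₁ ((ε : 𝓞 K) : K))
      ≤ ({I : Ideal (𝓞 K) | 1 ≤ Ideal.absNorm I ∧ Ideal.absNorm I ≤ ⌊2 * Real.sqrt d / Real.pi⌋₊}.ncard : ℝ) *
          Real.log (3 * Real.sqrt d) := h
    _ ≤ (2 / 3) ^ 10 * d ^ 5 * (3 * d) := mul_le_mul hcount hlog hlog0 (by positivity)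
    _ = (3 * (2 / 3) ^ 10) * d ^ 6 := by ring
    _ ≤ 1 * d ^ 6 := by gcongr; norm_num
    _ = d ^ 6 := one_mul _

/-- **S3b-T3a′ `stub_cubicReduction`.** In a cubic field with a real `σ₁` and a non-real `σ₂`:
(1) every nonzero fractional ideal `I` has a UNIQUE element `γ` of least `σ₁` in the unit cylinder
`{σ₁ > 0, ‖σ₂‖ < 1}`; it is a positive relative minimum with `N(I) < σ₁ γ ≤ 3 N(I) √|d_K|`
(`Literature…exists_cylinder_min`, Minkowski in the mixed space); (2) rescaling a positive minimum `θ`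
of `I` to `1` makes `1` a positive minimum of `θ⁻¹ I`; (3) reduced ideals `J` (`1` a positive minimum)
have `J ⊇ 𝓞_K`, `π/(2√|d_K|) ≤ N(J) ≤ 1`; (4) `R_K ≤ |d_K|⁶` (`regulator_le_abs_discr_pow_six`). -/
theorem stub_cubicReduction :
    ∀ (K : Type) [Field K] [NumberField K], Module.finrank ℚ K = 3 →
    ∀ (σ₁ : K →+* ℝ) (σ₂ : K →+* ℂ), (∃ z : K, starRingEnd ℂ (σ₂ z) ≠ σ₂ z) →
      (∀ (I : FractionalIdeal (𝓞 K)⁰ K), I ≠ 0 →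
        ∃ γ : K, γ ∈ I ∧ 0 < σ₁ γ ∧ ‖σ₂ γ‖ < 1 ∧
          (∀ φ : K, φ ∈ I → 0 < σ₁ φ → ‖σ₂ φ‖ < 1 → σ₁ γ ≤ σ₁ φ) ∧
          (∀ φ : K, φ ∈ I → 0 < σ₁ φ → ‖σ₂ φ‖ < 1 → σ₁ φ ≤ σ₁ γ → φ = γ) ∧
          γ ∈ posRelMinima σ₁ σ₂ I ∧
          (FractionalIdeal.absNorm I : ℝ) < σ₁ γ ∧
          σ₁ γ ≤ 3 * (FractionalIdeal.absNorm I : ℝ) * Real.sqrt |(NumberField.discr K : ℝ)|) ∧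
      (∀ (I : FractionalIdeal (𝓞 K)⁰ K) (θ : K), θ ∈ posRelMinima σ₁ σ₂ I →
        (1 : K) ∈ posRelMinima σ₁ σ₂ (FractionalIdeal.spanSingleton (𝓞 K)⁰ θ⁻¹ * I)) ∧
      (∀ (J : FractionalIdeal (𝓞 K)⁰ K), (1 : K) ∈ posRelMinima σ₁ σ₂ J →
        1 ≤ J ∧ (FractionalIdeal.absNorm J : ℝ) ≤ 1 ∧
          Real.pi / (2 * Real.sqrt |(NumberField.discr K : ℝ)|) ≤ (FractionalIdeal.absNorm J : ℝ)) ∧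
      NumberField.Units.regulator K ≤ |(NumberField.discr K : ℝ)| ^ 6 := by
  intro K _ _ hdeg σ₁ σ₂ hσ₂
  exact ⟨fun I hI => exists_cylinder_min hdeg hσ₂ hI, fun I θ hθ => one_mem_posRelMinima_spanSingleton_inv_mul hθ,
    fun J hJ => reducedIdeal_bounds hdeg hσ₂ hJ, regulator_le_abs_discr_pow_six K hdeg σ₁ σ₂ hσ₂⟩

end Summit.QuantumAdvantage.QuantumAdvantage.Theorems.LinnikCubicClassGroups
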